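import Literature.AnabelianGeometry.SemiGraphs.QuasiTemperoidsRmkA31Proofs
import Mathlib.CategoryTheory.Limits.Constructions.EpiMono
import HarnessLib

/-!
# Semi-graphs of anabelioids, Appendix, proof of Theorem A.4: the functor `D₂ → D₁` induced by
# `φ^*` on QD-pairs (definitions; preservation of 0-proper morphisms)

Mochizuki, *Semi-graphs of anabelioids*, Publ. RIMS **42** (2006) 221–322, Appendix, proof of
Theorem A.4, manuscript p. 85 (PRIMS p. 315 ll. 13–24)
[cite: MochizukiSemiAnbd2006, Thm A.4 proof p.85]: "Now observe that the functor `φ^* : Q₂ → Q₁`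
induces a 1-commutative diagram `Q₂ → D₂ → P₂` / `Q₁ → D₁ → P₁` [vertical arrows `φ^*`]. Indeed,
the construction of the second vertical arrow is immediate from the definitions. The construction of
the third vertical arrow follows by observing that since `φ^*` preserves countable colimits, it
follows that the functor `D₂ → D₁` preserves 0- and 1-proper morphisms [cf. Remark A.3.1]."

Sub-node **A4-φ** of `plan/L3/SUBDAG-SemiAnbd-Cor311.md` (holder abc-iut-w5-d129), part 1 of 2, over
the Definition A.3 vocabulary of `QuasiTemperoidsQDPairs.lean` (abc-iut-L3-t2: `QDPair`, the category
`D`, `Hom.IsZeroProper`, `Hom.IsOneProper`, `IsQuotient`) and Remark A.3.1 DISCHARGED (`rmkA31_holds`,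
abc-iut-w4-d048):

* `QDPair.mapFunctor F : QDPair Q ⥤ QDPair Q'` — "the second vertical arrow": any functor `F = φ^*`
  carries `(B, Γ_B)` to `(F B, F(Γ_B))` and morphisms of QD-pairs to morphisms of QD-pairs;
* `QDPair.trivialPairFunctor Q : Q ⥤ QDPair Q`, `B ↦ (B, {1})` — "the first functor maps an object
  `B` of `Q_i` to the QD-pair `(B, {1})`" (p. 85; it extends abc-iut-w5-d129's `QDPair.trivialPair`
  for `B^temp(Π)` to a functor on any `Q`) — and the 1-commutativity of the first square
  (`mapFunctor_obj_trivialPair`, strict on objects; `trivialPairFunctorCompMapFunctorIso`);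
* `QDPair.Hom.IsZeroProper.map` — `D₂ → D₁` PRESERVES 0-PROPER MORPHISMS as soon as `F` preserves
  epimorphisms (e.g. countable colimits, `preservesEpimorphisms_of_preservesCountableColimits`):
  Remark A.3.1 (a) ⇔ (b) in `Q₂` and in `Q₁`.

Part 2 (`QuasiTemperoidsQDPairFunctorQuotients.lean`): `φ^*` preserves quotients of QD-pairs and
1-proper morphisms.  The third vertical arrow `P₂ → P₁` (sub-node A4-lim) is not constructed here.
Elementary category theory; nothing refers to the IUT corpus; no side is taken on any disputed claim.
-/

open CategoryTheory CategoryTheory.Limits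

namespace Literature.AnabelianGeometry.SemiGraphs

open Literature.AlgebraicGeometry.Frobenioids.QuasiTemperoid (IsConnectedQuasiTemperoid)

universe v₁ v₂ u u' u₁ u₂

namespace QDPair

/-! ### The functor `D₂ → D₁` induced by `φ^*` ("immediate from the definitions") -/

section MapFunctor

variable {Q : Type u₁} [Category.{v₁} Q] {Q' : Type u₂} [Category.{v₂} Q'] (F : Q ⥤ Q')

/-- **The functor `D₂ → D₁` induced by `φ^* : Q₂ → Q₁`** on the categories of QD-pairs (proof of
Thm. A.4, p. 85, "the second vertical arrow is immediate from the definitions"): `(B, Γ_B) ↦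
(φ^* B, φ^*(Γ_B))`, `φ^*(Γ_B) ⊆ Aut(φ^* B)` the image subgroup, and a morphism of QD-pairs `f` to
`φ^* f` (if `γ_C ∘ f = f ∘ γ_B` then `φ^*γ_C ∘ φ^*f = φ^*f ∘ φ^*γ_B`). Stated for any functor `F`.
[cite: MochizukiSemiAnbd2006, Thm A.4 proof p.85] -/
def mapFunctor : QDPair Q ⥤ QDPair Q' where
  obj P := ⟨F.obj P.A, P.Γ.map (Functor.mapAut P.A F)⟩
  map {P₁ P₂} f := ⟨F.map f.hom, fun δ hδ => by
    obtain ⟨γ, hγ, rfl⟩ := Subgroup.mem_map.mp hδ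
    obtain ⟨γ', hγ', h⟩ := f.comm γ hγ
    exact ⟨Functor.mapAut P₂.A F γ', Subgroup.mem_map_of_mem _ hγ', by
      change F.map f.hom ≫ F.map γ'.hom = F.map γ.hom ≫ F.map f.hom
      rw [← F.map_comp, h, F.map_comp]⟩⟩
  map_id P := Hom.ext (F.map_id P.A)
  map_comp f g := Hom.ext (F.map_comp f.hom g.hom)

/-- `φ^*(B, Γ_B)` has underlying object `φ^* B`. [cite: MochizukiSemiAnbd2006, Thm A.4 proof p.85] -/
@[simp] theorem mapFunctor_obj_A (P : QDPair Q) : ((mapFunctor F).obj P).A = F.obj P.A := rfl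

/-- `φ^*(B, Γ_B)` has group `φ^*(Γ_B)`, the image of `Γ_B` under `Aut(B) → Aut(φ^* B)`.
[cite: MochizukiSemiAnbd2006, Thm A.4 proof p.85] -/
@[simp] theorem mapFunctor_obj_Γ (P : QDPair Q) :
    ((mapFunctor F).obj P).Γ = P.Γ.map (Functor.mapAut P.A F) := rfl

/-- `φ^*` on morphisms of QD-pairs is `φ^*` on the underlying arrows.
[cite: MochizukiSemiAnbd2006, Thm A.4 proof p.85] -/
@[simp] theorem mapFunctor_map_hom {P₁ P₂ : QDPair Q} (f : P₁ ⟶ P₂) :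
    ((mapFunctor F).map f).hom = F.map f.hom := rfl

/-- The elements of `φ^*(Γ_B)` are the `φ^* γ`, `γ ∈ Γ_B`. [cite: MochizukiSemiAnbd2006, Thm A.4 proof p.85] -/
theorem mem_mapFunctor_obj_Γ_iff (P : QDPair Q) (δ : Aut (F.obj P.A)) :
    δ ∈ ((mapFunctor F).obj P).Γ ↔ ∃ γ ∈ P.Γ, F.mapIso γ = δ :=
  Subgroup.mem_map

variable (Q) in
/-- **The first functor `Q_i → D_i`**, "maps an object `B` of `Q_i` to the QD-pair `(B, {1})`"
(proof of Thm. A.4, p. 85); an arrow `B → C` is a morphism of QD-pairs `(B, {1}) → (C, {1})`.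
[cite: MochizukiSemiAnbd2006, Thm A.4 proof p.85] -/
def trivialPairFunctor : Q ⥤ QDPair Q where
  obj B := ⟨B, ⊥⟩
  map f := ⟨f, fun γ hγ => ⟨1, Subgroup.one_mem _, by
    rw [(Subgroup.mem_bot.mp hγ : γ = 1)]
    change f ≫ 𝟙 _ = 𝟙 _ ≫ f
    rw [Category.comp_id, Category.id_comp]⟩⟩
  map_id _ := rfl
  map_comp _ _ := rfl

/-- `(B, {1})` has underlying object `B`. [cite: MochizukiSemiAnbd2006, Thm A.4 proof p.85] -/
@[simp] theorem trivialPairFunctor_obj_A (B : Q) : ((trivialPairFunctor Q).obj B).A = B := rfl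

/-- `(B, {1})` has trivial group. [cite: MochizukiSemiAnbd2006, Thm A.4 proof p.85] -/
@[simp] theorem trivialPairFunctor_obj_Γ (B : Q) : ((trivialPairFunctor Q).obj B).Γ = ⊥ := rfl

/-- `Q_i → D_i` on arrows is the arrow itself. [cite: MochizukiSemiAnbd2006, Thm A.4 proof p.85] -/
@[simp] theorem trivialPairFunctor_map_hom {B C : Q} (f : B ⟶ C) :
    ((trivialPairFunctor Q).map f).hom = f := rfl

/-- **The first square commutes** (strictly, on objects): `φ^*(B, {1}) = (φ^* B, {1})`.
[cite: MochizukiSemiAnbd2006, Thm A.4 proof p.85] -/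
theorem mapFunctor_obj_trivialPair (B : Q) :
    (mapFunctor F).obj ((trivialPairFunctor Q).obj B) = (trivialPairFunctor Q').obj (F.obj B) :=
  congrArg (QDPair.mk (F.obj B)) (Subgroup.map_bot _)

/-- The identity of `A` as a morphism of QD-pairs `(A, Γ) → (A, Γ')` for `Γ ⊆ Γ'`.
[cite: MochizukiSemiAnbd2006, Def A.3(ii) p.82] -/
def Hom.ofLE {A : Q} {Γ Γ' : Subgroup (Aut A)} (h : Γ ≤ Γ') : (⟨A, Γ⟩ : QDPair Q) ⟶ ⟨A, Γ'⟩ :=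
  ⟨𝟙 A, fun γ hγ => ⟨γ, h hγ, by rw [Category.id_comp, Category.comp_id]⟩⟩

/-- `Hom.ofLE` is the identity on underlying objects. [cite: MochizukiSemiAnbd2006, Def A.3(ii) p.82] -/
@[simp] theorem Hom.ofLE_hom {A : Q} {Γ Γ' : Subgroup (Aut A)} (h : Γ ≤ Γ') :
    (Hom.ofLE (Q := Q) h).hom = 𝟙 A := rfl

/-- QD-pairs with the same object and equal groups are isomorphic by the identity.
[cite: MochizukiSemiAnbd2006, Def A.3(ii) p.82] -/
def isoOfEq {A : Q} {Γ Γ' : Subgroup (Aut A)} (h : Γ = Γ') : (⟨A, Γ⟩ : QDPair Q) ≅ ⟨A, Γ'⟩ :=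
  ⟨Hom.ofLE h.le, Hom.ofLE h.ge, Hom.ext (Category.id_comp _), Hom.ext (Category.id_comp _)⟩

/-- **The first square is 1-commutative**: `(Q₂ → D₂ → D₁) ≅ (Q₂ → Q₁ → D₁)`, i.e.
`φ^* ∘ (B ↦ (B,{1})) ≅ (B ↦ (B,{1})) ∘ φ^*` (the identity on underlying arrows).
[cite: MochizukiSemiAnbd2006, Thm A.4 proof p.85] -/
def trivialPairFunctorCompMapFunctorIso :
    trivialPairFunctor Q ⋙ mapFunctor F ≅ F ⋙ trivialPairFunctor Q' :=
  NatIso.ofComponents (fun B => isoOfEq (Subgroup.map_bot (Functor.mapAut B F))) fun {B C} f => by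
    apply Hom.ext
    change F.map f ≫ 𝟙 (F.obj C) = 𝟙 (F.obj B) ≫ F.map f
    rw [Category.comp_id, Category.id_comp]

/-- A quotient of `(A, Γ)` that is invariant under a larger group `Γ' ⊇ Γ` is a quotient of
`(A, Γ')` (fewer test arrows). [cite: MochizukiSemiAnbd2006, Def A.3(iii) p.82] -/
theorem IsQuotient.of_le {P : QDPair Q} {B : Q} {φ : P.A ⟶ B} (hφ : P.IsQuotient φ)
    {Γ' : Subgroup (Aut P.A)} (hle : P.Γ ≤ Γ') (hinv : ∀ γ ∈ Γ', γ.hom ≫ φ = φ) :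
    (⟨P.A, Γ'⟩ : QDPair Q).IsQuotient φ :=
  ⟨hinv, fun _ ψ hψ => hφ.2 ψ fun γ hγ => hψ γ (hle hγ)⟩

end MapFunctor

/-! ### `D₂ → D₁` preserves 0-proper morphisms (Remark A.3.1 (a) ⇔ (b)) -/

section ZeroProper

variable {Q : Type u₁} [Category.{v₁} Q] {Q' : Type u₂} [Category.{v₂} Q'] (F : Q ⥤ Q')

/-- **`D₂ → D₁` preserves 0-proper morphisms** (proof of Thm. A.4, p. 85, "[cf. Remark A.3.1]"): for
connected quasi-temperoids `Q`, `Q'` and a functor `F : Q ⥤ Q'` preserving epimorphisms (e.g. one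
preserving pushouts — in particular one preserving countable colimits), if `f : (A, Γ_A) → (B, Γ_B)`
is 0-proper then so is `F f`: 0-proper ⟺ epimorphism by Remark A.3.1 (a) ⇔ (b) in `Q` and in `Q'`.
[cite: MochizukiSemiAnbd2006, Thm A.4 proof p.85] -/
theorem Hom.IsZeroProper.map (hQ : IsConnectedQuasiTemperoid.{v₁, u₁, u} Q)
    (hQ' : IsConnectedQuasiTemperoid.{v₂, u₂, u'} Q') [F.PreservesEpimorphisms]
    {P₁ P₂ : QDPair Q} {f : P₁ ⟶ P₂} (hf : Hom.IsZeroProper f) :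
    Hom.IsZeroProper ((mapFunctor F).map f) := by
  haveI : Epi f.hom := (rmkA31_holds.{v₁, u, u₁} Q hQ P₁ P₂ f).1.mp hf
  haveI : Epi (F.map f.hom) := inferInstance
  exact (rmkA31_holds.{v₂, u', u₂} Q' hQ' _ _ ((mapFunctor F).map f)).1.mpr this

/-- A functor preserving countable colimits ("since `φ^*` preserves countable colimits", p. 85) preserves
pushouts, hence epimorphisms. [cite: MochizukiSemiAnbd2006, Thm A.4 proof p.85] -/
theorem preservesEpimorphisms_of_preservesCountableColimits
    (hF : ∀ (J : Type) [SmallCategory J] [CountableCategory J], PreservesColimitsOfShape J F) :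
    F.PreservesEpimorphisms := by
  haveI : PreservesColimitsOfShape WalkingSpan F := hF WalkingSpan
  infer_instance

end ZeroProper

end QDPair

end Literature.AnabelianGeometry.SemiGraphs
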